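import Summits.BirchSwinnertonDyer.BirchSwinnertonDyer.Theses.QuadraticBranchSignedControl
import Summits.BirchSwinnertonDyer.BirchSwinnertonDyer.Theorems.QuadraticBranchSignedControlPlusLowerInclusionStubs
import Summits.BirchSwinnertonDyer.Rank1Residual.GaloisImage.SupersingularExactImage
import Literature.NumberTheory.SerreUniformity.Statement
import HarnessLib

/-!
# Route `QuadraticBranchSignedControl` (rung K8, cell `bsd-potss`): crux stmt-BirchSwinnertonDyer-19606
# `PlusEtaMainConjectureNonsurj` — ITS ROWS ARE EXACTLY THE `ℚ`-POINTS OF `X_ns⁺(p)` (kernel);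
# split into CM rows and non-CM normaliser-of-non-split-Cartan rows; the `p = 13, 17` non-CM rows
# are EMPTY by Balakrishnan–Dogra–Müller–Tuitman–Vonk

WHAT. The crux `PlusEtaMainConjectureNonsurj` (item 19606) is Kobayashi's even main conjecture on the
`η`-component (node `Additive.QuadraticBranchPlusEtaMainConjectureAt V p`, print currency) on the
good supersingular `a_p = 0` curves `V/ℚ`, `p ≥ 5`, whose `p`-adic tower is NOT onto
(`¬ ∀ m, ρ_{V,p^m}` onto). This file identifies that row condition EXACTLY, in the kernel:

* §1 `not_forall_surj_pow_iff_cartanNormalizer` — for `V/ℚ` globally minimal, `p ≥ 5` good with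
  `a_p = 0`: **`¬ (∀ m, ρ_{V,p^m} onto) ⟺ Im ρ̄_{V,p} = C_ns⁺(p)`** EXACTLY (the dossier predicate
  `SerreUniformity.HasModPImageEqNonsplitCartanNormalizer V p`), i.e. `V` is a non-cuspidal
  `ℚ`-point of `X_ns⁺(p)`: ⟸ by `C_ns⁺ ≠ GL₂` (`not_hasSurjectiveModNGaloisRep_of_hasNonsplitCartanModPImage`);
  ⟹ by Serre's `p ⇒ p^m` lifting (`hasSurjectiveModNGaloisRep_pow_iff`, p ≥ 5) and the tree's
  exact-image theorem at a good supersingular prime (`GaloisImage.hasModPImageEqNonsplitCartanNormalizer_of_goodSS_of_not_surj`,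
  n1011-p04: inertia = non-split Cartan `kˣ` (Serre 1972 Prop. 12), Prop. 17/14, `(N : C) = 2`).
* §2 `plusEtaMainConjectureNonsurj_iff_cartanRows` — hence **19606 ⟺ the even MC at `η` on the
  `X_ns⁺(p)`-rows**: `∀ V p, 5 ≤ p → good → a_p = 0 → Im ρ̄_{V,p} = C_ns⁺(p) → Node V p`.
* §3 `plusEtaMainConjectureNonsurj_of_cmRows_of_nonCMCartanRows` — the crux from its TWO
  populations displayed as hypotheses: the CM rows (`V.HasCM`; in print only Pollack–Rubin's remark
  p. 448 "with the same proof … for Sel±(E/ℚ(μ_{p^∞}))"; Kim–Park 2017 Thm. 1.1 needs `p` split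
  completely in `F/K`, which EXCLUDES the ramified `η = χ_{p*}`) and the NON-CM `X_ns⁺(p)` rows (no
  Euler-system equality in print: Kobayashi Thm. 4.1 has the `pⁿ` slack there).
* §4 `nonCMCartanRows_off_13_17` — GIVEN the published theorems BDMTV 2019 Cor. 1.3 and BDMTV 2023
  Thm. 1.2 (named facts `BDMTV2019_nonsplitCartan_level13`, `BDMTV2023_nonsplitCartan_level17`, as
  hypotheses): the non-CM rows have `p ∉ {13, 17}`; so
  `plusEtaMainConjectureNonsurj_of_cmRows_of_nonCMCartanRows_off_13_17`. (`X_ns⁺(p)(ℚ)` is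
  infinite for `p ∈ {5, 7, 11}` — genus `0, 0, 1` of positive rank — and UNKNOWN for primes
  `p ≥ 19`: Balakrishnan, ICM 2026, Problem 6.1 = Serre's uniformity question; under
  `SerreUniformityBound 37` (OPEN, hypothesis only) the non-CM rows have `p ≤ 37`,
  `nonCMCartanRows_le_37_of_serreUniformityBound`.)

CENSUS (evidence file `FINDING-19606-k8eta-c2-g0.md` on the item; Cremona `allcurves` + Sutherland
`galrep`, N_W < 5·10⁵, class representatives, W = V ⊗ χ_{p*} additive of Kodaira type I₀* with
supersingular twist): 16 730 rank ≤ 1 Gss2 pairs = 16 236 onto-tower + 494 non-onto; the non-onto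
rows are 466 CM pairs + 28 non-CM pairs, the latter ALL at `p = 5` with image `5Nn` (9 distinct
`j`-invariants); 11 of the cell's 739 rank-0 residue pairs (HOME ref/W12-GSS2-R0-TABLE) are such rows.

HONEST FRAMING (cell `bsd-potss`, run/shared/lean/pub/bsd-potss/; FULL-BSD rank ≤ 1 programme):
TOOL THEOREMS ONLY (no definition, no named fact, no `sorry`, axioms standard); §1–§3
UNCONDITIONAL, §4 conditional on the displayed published facts / the displayed open conjecture.
The crux 19606 is NOT proved (open problem on both populations); nothing is booked; `BSD(W, p)` is
claimed for no pair. Seat `bsd-potss-k8eta-c2` (prover), g0; `--supports stmt-BirchSwinnertonDyer-19606`.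

References: [Kobayashi2003] §4 Even main conjecture + Thm. 4.1 (p. 8); [PollackRubin2004] p. 448;
[Serre1972] §1.11 Prop. 12, §2.2, §2.7 Prop. 17, IV-20 Lemme 3; [FurioLombardo2023] Thm. 1.5;
[BalakrishnanEtAl2019] Cor. 1.3; [BalakrishnanEtAl2023] Thm. 1.2; [SerreKyoto1977] 6.5–6.6;
B. D. Kim–J. Park, Acta Arith. 181 (2017) Thm. 1.1 (hypotheses).
-/

set_option autoImplicit false
set_option linter.dupNamespace false

noncomputable section

open scoped Classical

open WeierstrassCurve Literature.NumberTheory.EllipticCurves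
  Literature.NumberTheory.EllipticCurves.Rank1Residual Literature.NumberTheory.SerreUniformity
  Summit.BirchSwinnertonDyer.Rank1Residual.Additive
  Summit.BirchSwinnertonDyer.BirchSwinnertonDyer.Theses.QuadraticBranchSignedControl

namespace Summit.BirchSwinnertonDyer.BirchSwinnertonDyer.Theorems

/-! ## §1 Non-onto tower ⟺ image exactly `C_ns⁺(p)` (good supersingular, `p ≥ 5`) -/

/-- **At a good supersingular `p ≥ 5` (`a_p = 0`): the `p`-adic tower of `V` is not onto iff the
mod-`p` image is EXACTLY the normaliser of a non-split Cartan subgroup** (`V` a `ℚ`-point of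
`X_ns⁺(p)`). ⟹: Serre's lifting (`p ≥ 5`: onto mod `p` ⇒ onto mod `p^m`) and the exact-image theorem
at a good supersingular prime (inertia = non-split Cartan, Serre 1972 Prop. 12; Prop. 17; `(N : C) = 2`);
⟸: `C_ns⁺(p) ≠ GL₂(𝔽_p)`. [cite: Serre1972, §1.11 Prop. 12, §2.7 Prop. 17, IV-20 Lemme 3]
[cite: FurioLombardo2023, Thm. 1.5 (second alternative)] -/
theorem not_forall_surj_pow_iff_cartanNormalizer (V : WeierstrassCurve ℚ) [V.IsElliptic]
    [V.IsGloballyMinimal] (p : ℕ) [Fact p.Prime] (hp5 : 5 ≤ p) (hgood : V.HasGoodReductionAtPrime p)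
    (hap : V.frobeniusTrace p = 0) :
    ¬ (∀ m : ℕ, V.HasSurjectiveModNGaloisRep (p ^ m : ℕ)) ↔
      HasModPImageEqNonsplitCartanNormalizer V p := by
  rw [hasSurjectiveModNGaloisRep_pow_iff V p hp5]
  have hp2 : p ≠ 2 := by omega
  have hss : GoodSS V p := ⟨hgood, by rw [hap]; exact dvd_zero _⟩
  constructor
  · intro hns
    exact Rank1Residual.GaloisImage.hasModPImageEqNonsplitCartanNormalizer_of_goodSS_of_not_surj V p
      hp2 hss hns
  · intro h
    exact not_hasSurjectiveModNGaloisRep_of_hasNonsplitCartanModPImage V h.hasNonsplitCartanModPImage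

/-! ## §2 The crux in `X_ns⁺(p)`-currency -/

/-- **Item 19606 `PlusEtaMainConjectureNonsurj` ⟺ Kobayashi's even main conjecture at `η` on the
`X_ns⁺(p)`-rows**: the good supersingular `a_p = 0` curves `V/ℚ`, `p ≥ 5`, whose mod-`p` image is
exactly `C_ns⁺(p)`. Both directions real (§1); the conjecture node is untouched (hypothesis /
conclusion positions only). [cite: Kobayashi2003, §4 Even main conjecture (p. 8)]
[cite: Serre1972, §1.11 Prop. 12, §2.7 Prop. 17] -/
theorem plusEtaMainConjectureNonsurj_iff_cartanRows :
    PlusEtaMainConjectureNonsurj ↔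
      ∀ (V : WeierstrassCurve ℚ) [V.IsElliptic] [V.IsGloballyMinimal] (p : ℕ) [Fact p.Prime],
        5 ≤ p → V.HasGoodReductionAtPrime p → V.frobeniusTrace p = 0 →
        HasModPImageEqNonsplitCartanNormalizer V p → QuadraticBranchPlusEtaMainConjectureAt V p := by
  unfold PlusEtaMainConjectureNonsurj
  constructor
  · intro h V _ _ p _ hp5 hgood hap hC
    exact h V p hp5 hgood hap ((not_forall_surj_pow_iff_cartanNormalizer V p hp5 hgood hap).mpr hC)
  · intro h V _ _ p _ hp5 hgood hap hns
    exact h V p hp5 hgood hap ((not_forall_surj_pow_iff_cartanNormalizer V p hp5 hgood hap).mp hns)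

/-! ## §3 The two populations: CM rows and non-CM `X_ns⁺(p)` rows -/

/-- **The crux from its two populations.** IF Kobayashi's even main conjecture at `η` holds (i) on
the CM rows (`V.HasCM`, `p ≥ 5` good supersingular — in print only as Pollack–Rubin's remark p. 448)
and (ii) on the NON-CM rows with image exactly `C_ns⁺(p)` (the non-CM `ℚ`-points of `X_ns⁺(p)`;
nothing in print), THEN `PlusEtaMainConjectureNonsurj`. Both displayed as hypotheses; nothing is
asserted; the kernel content is §1. [cite: Kobayashi2003, §4 (p. 8)] [cite: PollackRubin2004, p. 448 (remark)]
[cite: Serre1972, §1.11 Prop. 12, §2.7 Prop. 17] -/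
theorem plusEtaMainConjectureNonsurj_of_cmRows_of_nonCMCartanRows
    (hCM : ∀ (V : WeierstrassCurve ℚ) [V.IsElliptic] [V.IsGloballyMinimal] (p : ℕ) [Fact p.Prime],
        5 ≤ p → V.HasGoodReductionAtPrime p → V.frobeniusTrace p = 0 → V.HasCM →
        QuadraticBranchPlusEtaMainConjectureAt V p)
    (hNS : ∀ (V : WeierstrassCurve ℚ) [V.IsElliptic] [V.IsGloballyMinimal] (p : ℕ) [Fact p.Prime],
        5 ≤ p → V.HasGoodReductionAtPrime p → V.frobeniusTrace p = 0 → ¬ V.HasCM →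
        HasModPImageEqNonsplitCartanNormalizer V p → QuadraticBranchPlusEtaMainConjectureAt V p) :
    PlusEtaMainConjectureNonsurj := by
  rw [plusEtaMainConjectureNonsurj_iff_cartanRows]
  intro V _ _ p _ hp5 hgood hap hC
  by_cases hcm : V.HasCM
  · exact hCM V p hp5 hgood hap hcm
  · exact hNS V p hp5 hgood hap hcm hC

/-! ## §4 Where the non-CM rows live: `p ∉ {13, 17}` (BDMTV), `p ≤ 37` under Serre uniformity -/

/-- **GIVEN BDMTV 2019 Cor. 1.3 and BDMTV 2023 Thm. 1.2** (`X_ns⁺(13)(ℚ)` and `X_ns⁺(17)(ℚ)` consist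
of CM points; named facts in hypothesis position), a NON-CM row of the crux has `p ≠ 13` and
`p ≠ 17`. [cite: BalakrishnanEtAl2019, Cor. 1.3] [cite: BalakrishnanEtAl2023, Thm. 1.2] -/
theorem nonCMCartanRows_off_13_17 (h13 : BDMTV2019_nonsplitCartan_level13)
    (h17 : BDMTV2023_nonsplitCartan_level17) (V : WeierstrassCurve ℚ) [V.IsElliptic] (p : ℕ)
    (hncm : ¬ V.HasCM) (hC : HasModPImageEqNonsplitCartanNormalizer V p) : p ≠ 13 ∧ p ≠ 17 := by
  constructor
  · rintro rfl
    exact hncm (h13 V hC.hasNonsplitCartanModPImage)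
  · rintro rfl
    exact hncm (h17 V hC.hasNonsplitCartanModPImage)

/-- **The crux from the CM rows and the non-CM `X_ns⁺(p)` rows OFF `p ∈ {13, 17}`**, given the two
BDMTV theorems (named facts, hypothesis position). [cite: BalakrishnanEtAl2019, Cor. 1.3]
[cite: BalakrishnanEtAl2023, Thm. 1.2] [cite: Kobayashi2003, §4 (p. 8)] -/
theorem plusEtaMainConjectureNonsurj_of_cmRows_of_nonCMCartanRows_off_13_17
    (h13 : BDMTV2019_nonsplitCartan_level13) (h17 : BDMTV2023_nonsplitCartan_level17)
    (hCM : ∀ (V : WeierstrassCurve ℚ) [V.IsElliptic] [V.IsGloballyMinimal] (p : ℕ) [Fact p.Prime],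
        5 ≤ p → V.HasGoodReductionAtPrime p → V.frobeniusTrace p = 0 → V.HasCM →
        QuadraticBranchPlusEtaMainConjectureAt V p)
    (hNS : ∀ (V : WeierstrassCurve ℚ) [V.IsElliptic] [V.IsGloballyMinimal] (p : ℕ) [Fact p.Prime],
        5 ≤ p → p ≠ 13 → p ≠ 17 → V.HasGoodReductionAtPrime p → V.frobeniusTrace p = 0 →
        ¬ V.HasCM → HasModPImageEqNonsplitCartanNormalizer V p →
        QuadraticBranchPlusEtaMainConjectureAt V p) :
    PlusEtaMainConjectureNonsurj :=
  plusEtaMainConjectureNonsurj_of_cmRows_of_nonCMCartanRows hCM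
    fun V _ _ p _ hp5 hgood hap hncm hC =>
      hNS V p hp5 (nonCMCartanRows_off_13_17 h13 h17 V p hncm hC).1
        (nonCMCartanRows_off_13_17 h13 h17 V p hncm hC).2 hgood hap hncm hC

/-- **Under Serre's uniformity question with the expected bound `37`** (OPEN — hypothesis only,
`SerreUniformityBound 37`), a NON-CM row of the crux has `p ≤ 37`: the non-CM `X_ns⁺(p)` population
of 19606 would be supported on `5 ≤ p ≤ 37`, `p ∉ {13, 17}`. [cite: SerreKyoto1977, question 6.5, p. 187]
[cite: FurioLombardo2023, §1 (Question 1.1, bound 37)] -/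
theorem nonCMCartanRows_le_37_of_serreUniformityBound (hS : SerreUniformityBound 37)
    (V : WeierstrassCurve ℚ) [V.IsElliptic] (p : ℕ) [Fact p.Prime] (hncm : ¬ V.HasCM)
    (hC : HasModPImageEqNonsplitCartanNormalizer V p) : p ≤ 37 := by
  by_contra hlt
  exact not_hasSurjectiveModNGaloisRep_of_hasNonsplitCartanModPImage V hC.hasNonsplitCartanModPImage
    (hS V hncm p Fact.out (by omega))

end Summit.BirchSwinnertonDyer.BirchSwinnertonDyer.Theorems

end
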